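import Literature.NumberTheory.EllipticCurves.Kato2004.SemilocalDecompositionProofs
import Literature.NumberTheory.EllipticCurves.PAdicLFunctionBranchConstantTermProofs
import Literature.NumberTheory.EllipticCurves.KatoDivisibilityIntegralSkeletonProofs
import HarnessLib

/-!
# The branch index of Mazur–Tate–Teitelbaum §I.13 IS the Teichmüller character of Kato §12.1 /
# Wuthrich §3 (odd `p`) — PROVED

THEOREMS ONLY (no definition, no named fact; D-0014, D-0026). The tree carries TWO Teichmüller maps:

* the ANALYTIC one, `Literature.NumberTheory.EllipticCurves.teichRep p :
  (ℤ/p^{e₀})^× → μ_τ(ℤ_p)` (`PAdicLFunctionBranchConstantTermProofs`; `e₀ = cyclotomicExponent p`,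
  `τ = torsionOrder p = φ(p^{e₀})`), the Teichmüller representative by which the `ω^i`-branches
  `L_p(f, α, ω^i, T) = padicLFunctionBranch f α i` of the Mazur–Swinnerton-Dyer measure are cut out
  (Riemann sums over `η ∈ μ_τ(ℤ_p)` with weight `η^i`, constant term
  `∑_{a mod p^{e₀}} ω(a)^i μ_{f,α}(a + p^{e₀}ℤ_p)` with `ω(a) = teichRep a`, `teichWeight`;
  Mazur–Tate–Teitelbaum, Invent. Math. 84 (1986) §I.13: "`x = ω(x)·⟨x⟩`");
* the ALGEBRAIC one, `Kato2004.teichmullerChar p : (ℤ/p)^× →* ℤ_p^×`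
  (`SemilocalDecompositionProofs` §6; Lang GTM 121 Ch. 1 §2, Ch. 2 §2 Thm. 2.5: the unique
  character with `ω(a) ≡ a (mod p)`), i.e. Kato's `κ|_Δ` (Astérisque 295 §12.1, p. 219:
  `Δ ≅ ℤ/(p−1)`, branches `(σ − κ(σ)^j)`) and Wuthrich's "`Δ` acts on `M_i` by the `i`-th power of
  the Teichmüller character" (Doc. Math. 19 §3 p. 390), by whose powers the eigenspaces
  `M^{(ω^j)}` and the product formula `char_Λ(M) = ∏_{j<p−1} char_Λ(M^{(ω^j)})` of §6 are indexed.

Proved here, for every ODD prime `p` (`e₀ = 1`, `τ = p − 1`, `torsionOrder_of_ne_two`; the statements keep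
`ℤ/p^{e₀}` and reduce modulo `p` along `p ∣ p^{e₀}`, so no cast along `e₀ = 1` is needed):
* `coe_teichRep_eq_teichmullerChar : teichRep a = teichmullerChar (a mod p)` in `ℤ_p^×` for every
  unit class `a` modulo `p^{e₀}` (uniqueness `eq_teichmullerChar`: `teichRep a` is a `(p−1)`-th root
  of unity congruent to `a` modulo `p`, `toZMod_coe_teichRep` — every ring map `ℤ_p → ℤ/p` being
  `PadicInt.toZMod`), its `Λ^×`-valued form `map_C_teichRep_eq_teichmullerCharIwasawa`, and the
  weight identity `teichWeight_units_eq_teichmullerChar_pow : ω(a)^i = teichmullerChar(a mod p)^i`;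
* `teichmullerChar_toZMod_rootsOfUnity_torsionOrder : teichmullerChar (η mod p) = η` for
  `η ∈ μ_τ(ℤ_p)` (the Riemann-sum index), `rootsOfUnity_torsionOrder_of_ne_two : μ_τ = μ_{p−1}`;
* `bijective_unitsMap_castHom_of_ne_two`: reduction `(ℤ/p^{e₀})^× → (ℤ/p)^×` is a group
  isomorphism — the MTT index set IS Kato's `Δ = (ℤ/p)^×`.
So the `p − 1` analytic branches `B_i` of the tree's
`charIdeal_dvd_padicLFunction_cyclotomicPrime[_of_surjective]` (`∏_{i ∈ range (p−1)} B_i`) and the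
`p − 1` algebraic eigenspaces of `eigenDecompositionTeichmuller` / `prod_range_mem_charIdeal_teichmuller`
are indexed by the powers of ONE character `ω`; what is NOT here is the identification of Kato's
`𝔛(T)` with a dual Selmer datum carrying a `Λ`-linear `Δ`-action (the Galois side of the bridge), nor
`p = 2` (`e₀ = 2`, `τ = 2`, where `teichRep` is a character of `(ℤ/4)^×`, not of `(ℤ/2)^×`).

§2 (APPEND). **Kato Thm. 17.4 (3) over `ℚ(ζ_{p^∞})`, BRANCH BY BRANCH ⟹ the product membership.**
Kato prints Thm. 17.4 over the semi-local `Λ = O_λ[[G_∞]] = ∏_{j∈ℤ/(p−1)} Λ_j` (§12.1 (12.1.2),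
§17.3) as "`𝔛(T)` is a torsion `Λ`-module" and "`length_{Λ_𝔭}(𝔛(T)_𝔭) ≤ ord_𝔭(L_{p-adic,α,ω,γ}(f))`
for any prime ideal `𝔭` of `Λ` of height one" (p. 273); read on the `j`-th component `Λ_j ≅ ℤ_p⟦T⟧`
this is, for each `j < p − 1`, the length inequality for the eigenspace `𝔛^{(ω^j)}` at every
height-one prime of `ℤ_p⟦T⟧`. Combining the tree's all-primes bridge
`Module.mem_charIdeal_of_lengthAt_le` (file `KatoDivisibilityIntegralSkeletonProofs`) with §6 of
`SemilocalDecompositionProofs` gives, with no hypothesis beyond the printed ones: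
`prod_range_mem_charIdeal_teichmuller_of_lengthAt_le` — `(∀ j < p−1, ∀ 𝔮 height one,
length (M^{(ω^j)})_𝔮 ≤ length (Λ/g_j)_𝔮) ⟹ ∏_{j<p−1} g_j ∈ char_Λ(M)` — and, from Kato's
COHOMOLOGICAL inputs per branch (the skeleton `Kato2004.mem_charIdeal_of_skeleton_integral`:
(17.13.1) exact `H_j → P_j → M^{(ω^j)} → H2_j`, Thm. 12.4, Prop. 17.11, Thm. 16.6, and the Euler-system
bound Thm. 12.5 (4) at every height-one prime), `isTorsion_and_prod_range_mem_charIdeal_of_skeletons` —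
`M` is `Λ`-torsion (17.4 (1)) AND `∏_{j<p−1} G_j ∈ char_Λ(M)` (17.4 (3) in the product shape of the
tree's `charIdeal_dvd_padicLFunction_cyclotomicPrime_of_surjective`). The same for
`Δ = Gal(ℚ(ζ_p)/ℚ)` (`prod_range_mem_charIdeal_gal_of_lengthAt_le`). What stays a reading: that the
dual Selmer module of `E/ℚ(ζ_{p^∞})` with its `Δ`-action IS such an `M` with these skeleton data
(Galois side), and `G_j = L_p(E, ω^j, T)` (analytic side).

## References

* [MazurTateTeitelbaum1986Invent] B. Mazur, J. Tate, J. Teitelbaum, Invent. Math. 84 (1986), §I.13.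
* [Kato2004Asterisque] K. Kato, Astérisque 295 (2004), §12.1 (12.1.2), p. 219.
* [LangCyclotomic1990] S. Lang, *Cyclotomic Fields I and II*, GTM 121 (1990), Ch. 1 §2 (first
  paragraph); Ch. 2 §2 Thm. 2.5 (notation `ω : Z(p)^* → Z_p^*`, `ω(a) ≡ a mod p`).
* [Wuthrich2014] C. Wuthrich, Doc. Math. 19 (2014), §3 p. 390.
-/

set_option autoImplicit false

noncomputable section

open scoped Classical

namespace Literature.NumberTheory.EllipticCurves.Kato2004

/-! ### The analytic branch index IS the Teichmüller character: MTT §I.13's `ω(a) = teichRep a`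
(`PAdicLFunctionBranchConstantTermProofs`) equals `teichmullerChar (a mod p)` for odd `p` -/

section BranchLink

variable (p : ℕ) [Fact p.Prime]

/-- Every ring map `ℤ_p → ℤ/p` is `PadicInt.toZMod` (a copy of the tree's
`PadicInt.ringHom_eq_toZMod` in `BCDTModularityModPProofs`, not imported here to keep this file
free of the modularity stack). [folklore] -/
private theorem ringHom_padicInt_zmod_eq_toZMod (φ : ℤ_[p] →+* ZMod p) : φ = PadicInt.toZMod := by
  apply ZMod.ringHom_eq_of_ker_eq
  rw [PadicInt.ker_toZMod]
  refine ((IsLocalRing.maximalIdeal.isMaximal ℤ_[p]).eq_of_le (RingHom.ker_ne_top φ) ?_).symm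
  rw [PadicInt.maximalIdeal_eq_span_p, Ideal.span_le, Set.singleton_subset_iff, SetLike.mem_coe,
    RingHom.mem_ker, map_natCast, ZMod.natCast_self]

/-- For odd `p` the torsion of `ℤ_p^×` has order `τ = p − 1` (MTT §I.13: `τ = φ(p^{e₀})`, `e₀ = 1`).
[cite: MazurTateTeitelbaum1986Invent, §I.13] -/
theorem torsionOrder_of_ne_two (hp : p ≠ 2) : torsionOrder p = p - 1 := by
  rw [torsionOrder_eq, if_neg hp]


/-- For odd `p` the MTT torsion group `μ_τ(ℤ_p)` (the index set `η` of the branch Riemann sums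
`padicLBranchRiemannSum`, weights `η^i`) is `μ_{p−1}(ℤ_p)`, the domain of §6's `teichmullerEquiv`.
[cite: MazurTateTeitelbaum1986Invent, §I.13] -/
theorem rootsOfUnity_torsionOrder_of_ne_two (hp : p ≠ 2) :
    rootsOfUnity (torsionOrder p) ℤ_[p] = rootsOfUnity (p - 1) ℤ_[p] := by
  rw [torsionOrder_of_ne_two p hp]

/-- **`ω(η mod p) = η` on the MTT torsion `μ_τ(ℤ_p)` (odd `p`)**: the weight `η ↦ η^i` of the `ω^i`-branch
Riemann sums (`padicLBranchRiemannSum f α i`, "`ω^i(ηγ^t) = η^i`") is the `i`-th power of the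
Teichmüller character `teichmullerChar` of §6 evaluated at `η mod p`. [cite: MazurTateTeitelbaum1986Invent, §I.13]
[cite: LangCyclotomic1990, Ch. 1 §2 (first paragraph)] -/
theorem teichmullerChar_toZMod_rootsOfUnity_torsionOrder (hp : p ≠ 2)
    (η : rootsOfUnity (torsionOrder p) ℤ_[p]) :
    teichmullerChar p (Units.map (PadicInt.toZMod : ℤ_[p] →+* ZMod p).toMonoidHom (η : ℤ_[p]ˣ)) =
      (η : ℤ_[p]ˣ) := by
  refine (eq_teichmullerChar p ?_ ?_).symm
  · rw [← torsionOrder_of_ne_two p hp]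
    exact (mem_rootsOfUnity _ _).mp η.2
  · rw [Units.coe_map, RingHom.toMonoidHom_eq_coe, MonoidHom.coe_coe]

/-- The Teichmüller representative `teichRep a ∈ μ_τ(ℤ_p)` reduces modulo `p` to `a mod p`
(`ω(a) ≡ a (mod p^{e₀})` read modulo `p`). [cite: MazurTateTeitelbaum1986Invent, §I.13] -/
theorem toZMod_coe_teichRep (a : (ZMod (p ^ cyclotomicExponent p))ˣ) :
    PadicInt.toZMod (((teichRep p a : ℤ_[p]ˣ) : ℤ_[p])) =
      ZMod.castHom (dvd_pow_self p (cyclotomicExponent_ne_zero p)) (ZMod p)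
        ((a : (ZMod (p ^ cyclotomicExponent p))ˣ) : ZMod (p ^ cyclotomicExponent p)) := by
  have h := ringHom_padicInt_zmod_eq_toZMod p
    ((ZMod.castHom (dvd_pow_self p (cyclotomicExponent_ne_zero p)) (ZMod p)).comp
      (PadicInt.toZModPow (cyclotomicExponent p)))
  rw [← h, RingHom.comp_apply, ← val_teichReduce, teichReduce_teichRep]

/-- `teichRep a` is a `τ`-th root of unity in `ℤ_p^×`. [cite: MazurTateTeitelbaum1986Invent, §I.13] -/
theorem coe_teichRep_pow_torsionOrder (a : (ZMod (p ^ cyclotomicExponent p))ˣ) :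
    ((teichRep p a : rootsOfUnity (torsionOrder p) ℤ_[p]) : ℤ_[p]ˣ) ^ torsionOrder p = 1 :=
  (mem_rootsOfUnity _ _).mp (teichRep p a).2

/-- **The two Teichmüller maps of the tree agree (odd `p`)**: the Mazur–Tate–Teitelbaum branch
index `ω(a) = teichRep a ∈ μ_τ(ℤ_p)` of a unit class `a` modulo `p^{e₀}` (the weights `ω(a)^i` of
the `ω^i`-branches `L_p(f, α, ω^i, T)`, `PAdicLFunctionBranch`) is the value at `a mod p` of the
Teichmüller CHARACTER `teichmullerChar : (ℤ/p)^× →* ℤ_p^×` of §6 (Kato's `κ|_Δ`, Wuthrich's `ω`) —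
by the uniqueness `eq_teichmullerChar` (`τ = p − 1`, `teichRep a ≡ a (mod p)`). So the analytic
branches and the algebraic eigenspaces `M^{(ω^j)}` of §6 are indexed by the powers of ONE character.
[cite: MazurTateTeitelbaum1986Invent, §I.13] [cite: Kato2004Asterisque, §12.1 (12.1.2) (p. 219)]
[cite: LangCyclotomic1990, Ch. 1 §2 (first paragraph)] -/
theorem coe_teichRep_eq_teichmullerChar (hp : p ≠ 2) (a : (ZMod (p ^ cyclotomicExponent p))ˣ) :
    ((teichRep p a : rootsOfUnity (torsionOrder p) ℤ_[p]) : ℤ_[p]ˣ) =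
      teichmullerChar p (Units.map
        (ZMod.castHom (dvd_pow_self p (cyclotomicExponent_ne_zero p)) (ZMod p)).toMonoidHom a) := by
  refine eq_teichmullerChar p ?_ ?_
  · rw [← torsionOrder_of_ne_two p hp]
    exact coe_teichRep_pow_torsionOrder p a
  · rw [toZMod_coe_teichRep, Units.coe_map, RingHom.toMonoidHom_eq_coe, MonoidHom.coe_coe]

/-- The same in `Λ^× ⊃ ℤ_p^×`: `C(teichRep a) = ω_Λ(a mod p)` (`teichmullerCharIwasawa`).
[cite: Kato2004Asterisque, §12.1 (12.1.2) (p. 219)] [cite: MazurTateTeitelbaum1986Invent, §I.13] -/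
theorem map_C_teichRep_eq_teichmullerCharIwasawa (hp : p ≠ 2)
    (a : (ZMod (p ^ cyclotomicExponent p))ˣ) :
    Units.map (PowerSeries.C (R := ℤ_[p])).toMonoidHom
        ((teichRep p a : rootsOfUnity (torsionOrder p) ℤ_[p]) : ℤ_[p]ˣ) =
      teichmullerCharIwasawa p (Units.map
        (ZMod.castHom (dvd_pow_self p (cyclotomicExponent_ne_zero p)) (ZMod p)).toMonoidHom a) := by
  rw [coe_teichRep_eq_teichmullerChar p hp]
  rfl

/-- The MTT weight `a ↦ ω(a)^i` on the unit classes modulo `p^{e₀}` (`teichWeight`, the integrand of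
the constant term of the `ω^i`-branch) is `(teichmullerChar (a mod p))^i` for odd `p`.
[cite: MazurTateTeitelbaum1986Invent, §I.13] [cite: Kato2004Asterisque, §12.1 (12.1.2) (p. 219)] -/
theorem teichWeight_units_eq_teichmullerChar_pow (hp : p ≠ 2) (i : ℕ)
    (a : (ZMod (p ^ cyclotomicExponent p))ˣ) :
    teichWeight p i ((a : (ZMod (p ^ cyclotomicExponent p))ˣ) : ZMod (p ^ cyclotomicExponent p)) =
      ((((teichmullerChar p (Units.map
        (ZMod.castHom (dvd_pow_self p (cyclotomicExponent_ne_zero p)) (ZMod p)).toMonoidHom a) :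
          ℤ_[p]ˣ) : ℤ_[p]) : ℚ_[p])) ^ i := by
  rw [teichWeight_units, coe_teichRep_eq_teichmullerChar p hp]

/-- For odd `p` the MTT index set `(ℤ/p^{e₀})^×` IS Kato's `Δ = (ℤ/p)^×`: reduction modulo `p` is a
group isomorphism (`e₀ = 1`; injective because `teichmullerChar ∘ (mod p) = teichRep` is injective,
and both groups have `p − 1` elements). [cite: MazurTateTeitelbaum1986Invent, §I.13]
[cite: Kato2004Asterisque, §12.1 (p. 219)] -/
theorem bijective_unitsMap_castHom_of_ne_two (hp : p ≠ 2) :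
    Function.Bijective (Units.map
      (ZMod.castHom (dvd_pow_self p (cyclotomicExponent_ne_zero p)) (ZMod p)).toMonoidHom :
        (ZMod (p ^ cyclotomicExponent p))ˣ → (ZMod p)ˣ) := by
  haveI : NeZero (p ^ cyclotomicExponent p) := ⟨pow_ne_zero _ (Fact.out : p.Prime).ne_zero⟩
  rw [Fintype.bijective_iff_injective_and_card]
  refine ⟨fun a b hab => ?_, ?_⟩
  · have h : ((teichRep p a : rootsOfUnity (torsionOrder p) ℤ_[p]) : ℤ_[p]ˣ) =
        ((teichRep p b : rootsOfUnity (torsionOrder p) ℤ_[p]) : ℤ_[p]ˣ) := by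
      rw [coe_teichRep_eq_teichmullerChar p hp, coe_teichRep_eq_teichmullerChar p hp, hab]
    have h' : teichRep p a = teichRep p b := Subtype.ext h
    simpa only [teichReduce_teichRep] using congr_arg (teichReduce p) h'
  · rw [ZMod.card_units_eq_totient, ZMod.card_units, ← torsionOrder_of_ne_two p hp]
    rfl

end BranchLink

/-! ### §2 (APPEND) Kato Thm. 17.4 (3) over `ℚ(ζ_{p^∞})`, branch by branch ⟹ `∏_{j<p−1} g_j ∈ char_Λ(M)` -/

section SemilocalSkeleton

open Literature.NumberTheory.EllipticCurves.Module

variable (p : ℕ) [Fact p.Prime] {M : Type*} [AddCommGroup M] [Module (IwasawaAlgebra p) M]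

/-- **Kato's printed inequalities on every branch ⟹ the product membership** (`Δ = (ℤ/p)^×`,
`Λ = ℤ_p⟦T⟧`, every prime `p`): if `M` is a finitely generated torsion `Λ`-module with a `Λ`-linear
action of `(ℤ/p)^×` and, for every `j < p − 1` and every height-one prime `𝔮` of `Λ`,
`length_{Λ_𝔮}((M^{(ω^j)})_𝔮) ≤ length_{Λ_𝔮}((Λ/g_j)_𝔮)` ("`length_{Λ_𝔭}(𝔛_𝔭) ≤ ord_𝔭(L)` for any
prime ideal `𝔭` of `Λ` of height one", read on the `j`-th component of `Λ[Δ] = ∏_j Λ_j`), `g_j ≠ 0`,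
then `∏_{j<p−1} g_j ∈ char_Λ(M)` (`Module.mem_charIdeal_of_lengthAt_le` on each eigenspace, then
`prod_range_mem_charIdeal_teichmuller`). [cite: Kato2004Asterisque, Thm. 17.4 (3) (p. 273), §12.1 (12.1.2)–(12.1.3) (pp. 219–220)]
[cite: Wuthrich2014, §3 p. 390, Thm. 16 (p. 393)] -/
theorem prod_range_mem_charIdeal_teichmuller_of_lengthAt_le [Module.Finite (IwasawaAlgebra p) M]
    (ρ : Representation (IwasawaAlgebra p) (ZMod p)ˣ M)
    (hM : Module.IsTorsion (IwasawaAlgebra p) M) {g : ℕ → IwasawaAlgebra p}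
    (hg0 : ∀ j < p - 1, g j ≠ 0)
    (h : ∀ j < p - 1, ∀ 𝔮 : PrimeSpectrum (IwasawaAlgebra p), 𝔮.asIdeal.height = 1 →
      lengthAt (IwasawaAlgebra p) (eigenSubmodule ρ (teichmullerCharIwasawa p ^ j)) 𝔮 ≤
        lengthAt (IwasawaAlgebra p) (IwasawaAlgebra p ⧸ Ideal.span {g j}) 𝔮) :
    ∏ j ∈ Finset.range (p - 1), g j ∈ charIdeal (IwasawaAlgebra p) M := by
  refine prod_range_mem_charIdeal_teichmuller p ρ hM fun j hj => ?_
  haveI := finite_eigenSubmodule ρ (isUnit_card_iwasawaAlgebra p (ZMod p)ˣ (ZMod.card_units p).dvd)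
    (teichmullerCharIwasawa p ^ j)
  exact mem_charIdeal_of_lengthAt_le (isTorsion_eigenSubmodule ρ hM _) (hg0 j hj) (h j hj)

/-- The same for Wuthrich's `Δ = Gal(ℚ(ζ_p)/ℚ)` acting through `σ ↦ a`, `σ(ζ) = ζ^a`
(`galTeichmullerChar`). [cite: Wuthrich2014, §3 p. 390, Thm. 16 (p. 393)]
[cite: Kato2004Asterisque, Thm. 17.4 (3) (p. 273)] -/
theorem prod_range_mem_charIdeal_gal_of_lengthAt_le {X : Type*} [AddCommGroup X]
    [Module (IwasawaAlgebra p) X] [Module.Finite (IwasawaAlgebra p) X]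
    (ρ : Representation (IwasawaAlgebra p) (CyclotomicField p ℚ ≃ₐ[ℚ] CyclotomicField p ℚ) X)
    (hX : Module.IsTorsion (IwasawaAlgebra p) X) {g : ℕ → IwasawaAlgebra p}
    (hg0 : ∀ j < p - 1, g j ≠ 0)
    (h : ∀ j < p - 1, ∀ 𝔮 : PrimeSpectrum (IwasawaAlgebra p), 𝔮.asIdeal.height = 1 →
      lengthAt (IwasawaAlgebra p) (eigenSubmodule ρ (galTeichmullerChar p ^ j)) 𝔮 ≤
        lengthAt (IwasawaAlgebra p) (IwasawaAlgebra p ⧸ Ideal.span {g j}) 𝔮) :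
    ∏ j ∈ Finset.range (p - 1), g j ∈ charIdeal (IwasawaAlgebra p) X := by
  refine prod_range_mem_charIdeal_gal p ρ hX fun j hj => ?_
  haveI := finite_eigenSubmodule ρ (isUnit_card_iwasawaAlgebra p
    (CyclotomicField p ℚ ≃ₐ[ℚ] CyclotomicField p ℚ) (card_gal_cyclotomicField p).dvd)
    (galTeichmullerChar p ^ j)
  exact mem_charIdeal_of_lengthAt_le (isTorsion_eigenSubmodule ρ hX _) (hg0 j hj) (h j hj)

/-- **Kato Thm. 17.4 (1) and (3) over `ℚ(ζ_{p^∞})` from `p − 1` BRANCH SKELETONS.** For each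
`j < p − 1` let the cohomological inputs of §17.13 be given on the `ω^j`-eigenspace of `M`
(hypotheses exactly as in `Kato2004.mem_charIdeal_of_skeleton_integral`: an exact
`H_j →loc P_j →toX M^{(ω^j)} →δ H2_j` ((17.13.1) on the `j`-th component), `H_j` torsion free of rank
`≤ 1` and `H2_j` torsion (Thm. 12.4), `col_j : P_j ↪ Λ` (Prop. 17.11), `Z_j ≤ H_j` with
`G_j ∈ col_j(loc_j Z_j)`, `G_j ≠ 0` (Thm. 16.6), and the Euler-system bound
`length (H2_j)_𝔮 ≤ length (H_j/Z_j)_𝔮` at every height-one `𝔮` (Thm. 12.5 (4), `p ≠ 2`, (12.5.2))).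
Then `M` is `Λ`-torsion ("`𝔛(T)` is a torsion `Λ`-module", 17.4 (1), via
`isTorsion_iff_forall_eigenSubmodule_teichmuller`) and `∏_{j<p−1} G_j ∈ char_Λ(M)` (17.4 (3) in the
product shape `∏_{i<p−1} B_i` of the tree's `charIdeal_dvd_padicLFunction_cyclotomicPrime_of_surjective`).
[cite: Kato2004Asterisque, Thm. 17.4 (1), (3) (p. 273), §17.13 (pp. 279–280), §12.1 (12.1.2) (p. 219)] -/
theorem isTorsion_and_prod_range_mem_charIdeal_of_skeletons [Module.Finite (IwasawaAlgebra p) M]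
    (ρ : Representation (IwasawaAlgebra p) (ZMod p)ˣ M)
    {H P H2 : ℕ → Type*} [∀ j, AddCommGroup (H j)] [∀ j, Module (IwasawaAlgebra p) (H j)]
    [∀ j, AddCommGroup (P j)] [∀ j, Module (IwasawaAlgebra p) (P j)]
    [∀ j, AddCommGroup (H2 j)] [∀ j, Module (IwasawaAlgebra p) (H2 j)]
    [∀ j, Module.IsTorsionFree (IwasawaAlgebra p) (H j)]
    (hrank : ∀ j < p - 1, Module.rank (IwasawaAlgebra p) (H j) ≤ 1)
    (loc : ∀ j, H j →ₗ[IwasawaAlgebra p] P j)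
    (toX : ∀ j, P j →ₗ[IwasawaAlgebra p] eigenSubmodule ρ (teichmullerCharIwasawa p ^ j))
    (δ : ∀ j, eigenSubmodule ρ (teichmullerCharIwasawa p ^ j) →ₗ[IwasawaAlgebra p] H2 j)
    (hPX : ∀ j < p - 1, Function.Exact (loc j) (toX j))
    (hXH : ∀ j < p - 1, Function.Exact (toX j) (δ j))
    (col : ∀ j, P j →ₗ[IwasawaAlgebra p] IwasawaAlgebra p)
    (hcol : ∀ j < p - 1, Function.Injective (col j))
    (hH2 : ∀ j < p - 1, Module.IsTorsion (IwasawaAlgebra p) (H2 j))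
    (Z : ∀ j, Submodule (IwasawaAlgebra p) (H j)) {G : ℕ → IwasawaAlgebra p}
    (hG : ∀ j < p - 1, G j ≠ 0)
    (hGZ : ∀ j < p - 1, G j ∈ Submodule.map (col j ∘ₗ loc j) (Z j))
    (hES : ∀ j < p - 1, ∀ 𝔮 : PrimeSpectrum (IwasawaAlgebra p), 𝔮.asIdeal.height = 1 →
      lengthAt (IwasawaAlgebra p) (H2 j) 𝔮 ≤ lengthAt (IwasawaAlgebra p) (H j ⧸ Z j) 𝔮) :
    Module.IsTorsion (IwasawaAlgebra p) M ∧
      ∏ j ∈ Finset.range (p - 1), G j ∈ charIdeal (IwasawaAlgebra p) M := by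
  have hunit : IsUnit (Fintype.card (ZMod p)ˣ : IwasawaAlgebra p) :=
    isUnit_card_iwasawaAlgebra p (ZMod p)ˣ (ZMod.card_units p).dvd
  have hbranch : ∀ j < p - 1,
      Module.IsTorsion (IwasawaAlgebra p) (eigenSubmodule ρ (teichmullerCharIwasawa p ^ j)) ∧
        G j ∈ charIdeal (IwasawaAlgebra p) (eigenSubmodule ρ (teichmullerCharIwasawa p ^ j)) := by
    intro j hj
    haveI := finite_eigenSubmodule ρ hunit (teichmullerCharIwasawa p ^ j)
    exact Kato2004.mem_charIdeal_of_skeleton_integral p (hrank j hj) (loc j) (toX j) (δ j)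
      (hPX j hj) (hXH j hj) (col j) (hcol j hj) (hH2 j hj) (Z j) (hG j hj) (hGZ j hj) (hES j hj)
  have hM : Module.IsTorsion (IwasawaAlgebra p) M :=
    (isTorsion_iff_forall_eigenSubmodule_teichmuller p ρ).mpr fun j hj => (hbranch j hj).1
  exact ⟨hM, prod_range_mem_charIdeal_teichmuller p ρ hM fun j hj => (hbranch j hj).2⟩

end SemilocalSkeleton

end Literature.NumberTheory.EllipticCurves.Kato2004

end
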